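import Summits.BirchSwinnertonDyer.BirchSwinnertonDyer.Theorems.ManinLocalTwoThreeShimuraIndexMuThree
import Summits.BirchSwinnertonDyer.BirchSwinnertonDyer.Theorems.ManinLocalTwoThreeShimuraThreeKernelLine
import HarnessLib

/-!
# `μ₃ ⊂ W` from a rational `3`-torsion point and a SECOND rational root of `Ψ₃` (the Hesse split criterion on the short model)

Cell bsd-f2-manin, prover seat p3 g17; a dictionary lemma for the `p = 3` Shimura nodes E-an-221 / E-an-225 / E-an-223–224.
On a short Weierstrass curve `y² = x³ + a x + b` over `ℚ` let `P = (x₁, y₁)` be a rational point of order `3` (`Ψ₃(x₁) = 0`, `y₁ ≠ 0`)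
and let `X₀ ≠ x₁` be another rational root of `Ψ₃`.  Then

  `X₀³ + a X₀ + b = −3 · ((λ (X₀ − x₁) + 3 y₁)/3)²`,  `λ = (3x₁² + a)/(2y₁)`  (`sq_eq_neg_three_mul_sq_of_two_roots`)

(move `P` to the origin with horizontal flex tangent: the model becomes `y² + 2λ x y + 2y₁ y = x³`, whose `Ψ₃` is `x·(3x³ + 4λ²x² + 12λy₁x +
12y₁²)`, and `12(x³ + (λx + y₁)²) + (2λx + 6y₁)² = 4·(3x³ + 4λ²x² + 12λy₁x + 12y₁²)`).  Hence the `3`-division points above `X₀` have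
ordinates in `√−3 · ℚˣ` — the subgroup they generate is `μ₃` — which is the Weil-pairing statement «`E[3] ⊇ ℤ/3` and a second
`Γ_ℚ`-stable line ⟹ `E[3] ≅ ℤ/3 ⊕ μ₃`» in coordinates.  Consequences (tree vocabulary):
* `hasShortMuThree_of_isShortThreeTorsion_of_isRoot_of_neg`: `IsShortThreeTorsion W c x₁ y₁`, `Ψ₃^{E_{W,c}}(X₀) = 0`,
  `X₀³ + a₄X₀ + a₆ < 0` ⟹ `HasShortMuThree W c`;
* `hasShortMuThree_of_kummerShimura_of_isShortThreeTorsion`: on the Kummer–Shimura stratum at `9 ∣ N` (lead g17's pinned kernel: a `K`-point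
  `(X₀, Y₀)` lifting `u` has `Y₀² = r < 0`, `sq_lt_zero_of_kummerShimura`) a rational point of order `3` on `E_{W,c}` forces `μ₃ ⊂ W` — so
  E-an-221 (now ⟸ print, `…CThreeOfSixPrintedFacts`) upgrades to the `μ`-type node E-an-225 there, GIVEN the `K`-point.
Pure algebra + by-name composition; BSD is not proved by this; Manin's conjecture is not proved.
-/

set_option autoImplicit false
set_option linter.dupNamespace false

noncomputable section

open WeierstrassCurve Literature.NumberTheory.EllipticCurves Literature.NumberTheory.EllipticCurves.ModularForms
open Summit.BirchSwinnertonDyer.Rank1Residual.ManinAdditive.CuspidalKummer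
open Summit.BirchSwinnertonDyer.Rank1Residual.ManinAdditive.CuspidalKummerThree
open Summit.BirchSwinnertonDyer.Rank1Residual.ManinAdditive.KatoCurve
open Summit.BirchSwinnertonDyer.Rank1Residual.ManinAdditive.UDCKummerLineK

namespace Summit.BirchSwinnertonDyer.BirchSwinnertonDyer.Theorems.ManinLocalTwoThree.HesseSplit

/-! ### §1. The identity -/

/-- **`X₀³ + aX₀ + b = −3·T₀²`** for a second rational `Ψ₃`-root `X₀ ≠ x₁` next to a rational `3`-torsion point `(x₁, y₁)`, `y₁ ≠ 0`,
with `T₀ = (λ(X₀ − x₁) + 3y₁)/3`, `λ = (3x₁² + a)/(2y₁)`. [folklore] -/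
theorem sq_eq_neg_three_mul_sq_of_two_roots {a b x₁ y₁ X₀ : ℚ}
    (hE : y₁ ^ 2 = x₁ ^ 3 + a * x₁ + b) (hy : y₁ ≠ 0)
    (hΨ₁ : 3 * x₁ ^ 4 + 6 * a * x₁ ^ 2 + 12 * b * x₁ - a ^ 2 = 0)
    (hΨ₀ : 3 * X₀ ^ 4 + 6 * a * X₀ ^ 2 + 12 * b * X₀ - a ^ 2 = 0) (hne : X₀ ≠ x₁) :
    X₀ ^ 3 + a * X₀ + b = -3 * (((3 * x₁ ^ 2 + a) / (2 * y₁) * (X₀ - x₁) + 3 * y₁) / 3) ^ 2 := by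
  set l : ℚ := (3 * x₁ ^ 2 + a) / (2 * y₁) with hl
  have hlam : 2 * y₁ * l = 3 * x₁ ^ 2 + a := by
    rw [hl]; field_simp
  -- the flex condition `λ² = 3x₁` (⟸ Ψ₃(x₁) = 0)
  have hflex4 : 4 * y₁ ^ 2 * (l ^ 2 - 3 * x₁) = 0 := by
    linear_combination (2 * y₁ * l + (3 * x₁ ^ 2 + a)) * hlam - 12 * x₁ * hE - hΨ₁
  have hflex : l ^ 2 = 3 * x₁ := by
    have h4 : (4 : ℚ) * y₁ ^ 2 ≠ 0 := mul_ne_zero (by norm_num) (pow_ne_zero 2 hy)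
    have := (mul_eq_zero.mp hflex4).resolve_left h4
    linarith
  -- the cubic cofactor: Ψ₃(X₀) − Ψ₃(x₁) = (X₀ − x₁)·Q
  have hQd : (X₀ - x₁) * (3 * (X₀ ^ 3 + X₀ ^ 2 * x₁ + X₀ * x₁ ^ 2 + x₁ ^ 3) + 6 * a * (X₀ + x₁) + 12 * b) = 0 := by
    linear_combination hΨ₀ - hΨ₁
  have hQ : 3 * (X₀ ^ 3 + X₀ ^ 2 * x₁ + X₀ * x₁ ^ 2 + x₁ ^ 3) + 6 * a * (X₀ + x₁) + 12 * b = 0 :=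
    (mul_eq_zero.mp hQd).resolve_left (sub_ne_zero.mpr hne)
  linear_combination ((X₀ - x₁) ^ 2 / 3) * hflex + (X₀ - x₁) * hlam + 3 * hE + (1 / 3) * hQ

/-! ### §2. `HasShortMuThree` from a rational `3`-torsion point and a negative second root -/

/-- For the short model `E_{W,c}` (`a₁ = a₂ = a₃ = 0`): a rational point of order `3` and a rational `Ψ₃`-root `X₀` with
`X₀³ + a₄X₀ + a₆ < 0` give `μ₃ ⊂ W` (`HasShortMuThree W c`, witness `T₀ = (λ(X₀ − x₁) + 3y₁)/3 ≠ 0`). [folklore] -/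
theorem hasShortMuThree_of_isShortThreeTorsion_of_isRoot_of_neg (W : WeierstrassCurve ℚ) (c : ℤ) {x₁ y₁ X₀ : ℚ}
    (hP : IsShortThreeTorsion W c x₁ y₁) (hX : (shortModel W c).Ψ₃.IsRoot X₀)
    (hneg : X₀ ^ 3 + (shortModel W c).a₄ * X₀ + (shortModel W c).a₆ < 0) : HasShortMuThree W c := by
  obtain ⟨hns, hΨ₁⟩ := hP
  rw [WeierstrassCurve.Affine.nonsingular_iff', WeierstrassCurve.Affine.equation_iff'] at hns
  obtain ⟨heq, hder⟩ := hns
  rw [isRoot_Ψ₃_iff] at hΨ₁ hX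
  have ha₁ : (shortModel W c).a₁ = 0 := rfl
  have ha₂ : (shortModel W c).a₂ = 0 := rfl
  have ha₃ : (shortModel W c).a₃ = 0 := rfl
  simp only [WeierstrassCurve.b₂, WeierstrassCurve.b₄, WeierstrassCurve.b₆, WeierstrassCurve.b₈, ha₁, ha₂, ha₃] at hΨ₁ hX heq hder
  set a := (shortModel W c).a₄ with ha
  set b := (shortModel W c).a₆ with hb
  have hE : y₁ ^ 2 = x₁ ^ 3 + a * x₁ + b := by linear_combination heq
  have hΨ₁' : 3 * x₁ ^ 4 + 6 * a * x₁ ^ 2 + 12 * b * x₁ - a ^ 2 = 0 := by linear_combination hΨ₁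
  have hΨ₀' : 3 * X₀ ^ 4 + 6 * a * X₀ ^ 2 + 12 * b * X₀ - a ^ 2 = 0 := by linear_combination hX
  -- `y₁ ≠ 0`: else `(3x₁² + a)² = 12x₁(x₁³ + a x₁ + b) − Ψ₃(x₁) = 0`, a singular point
  have hy : y₁ ≠ 0 := by
    intro hy0
    have h0 : x₁ ^ 3 + a * x₁ + b = 0 := by rw [← hE, hy0]; ring
    have hsq : (3 * x₁ ^ 2 + a) ^ 2 = 0 := by linear_combination 12 * x₁ * h0 - hΨ₁'
    have h3 : 3 * x₁ ^ 2 + a = 0 := pow_eq_zero_iff (n := 2) (by norm_num) |>.mp hsq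
    rcases hder with h | h
    · apply h; linear_combination -h3
    · apply h; rw [hy0]; ring
  have hne : X₀ ≠ x₁ := by
    rintro rfl
    have : (0 : ℚ) ≤ y₁ ^ 2 := sq_nonneg _
    linarith
  have hid := sq_eq_neg_three_mul_sq_of_two_roots hE hy hΨ₁' hΨ₀' hne
  refine ⟨X₀, ((3 * x₁ ^ 2 + a) / (2 * y₁) * (X₀ - x₁) + 3 * y₁) / 3, (isRoot_Ψ₃_iff _ _).mpr ?_, ?_, ?_⟩
  · simp only [WeierstrassCurve.b₂, WeierstrassCurve.b₄, WeierstrassCurve.b₆, WeierstrassCurve.b₈, ha₁, ha₂, ha₃]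
    linear_combination hX
  · intro hT0
    rw [hT0] at hid
    linarith
  · linear_combination hid

/-! ### §3. On the Kummer–Shimura stratum: rational `3`-torsion ⟹ `μ₃ ⊂ W` (given the `K`-point) -/

/-- **On lead g17's pinned Kummer–Shimura kernel (`9 ∣ N`, lattice-optimal `D`, `KummerShimura D u`, a `K`-point `(X₀, Y₀)` of the short model
lifting `u`)**: a rational point of order `3` on `E_{W,c}` forces `μ₃ ⊂ W` — the kernel point has `Y₀² = r < 0` (`sq_lt_zero_of_kummerShimura`), so
its rational abscissa is a second `Ψ₃`-root with negative cubic value.  With E-an-221 (⟸ four printed facts, `…CThreeOfSixPrintedFacts`) this is the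
`μ`-type node E-an-225 on that stratum, given the `K`-point. [folklore] -/
theorem hasShortMuThree_of_kummerShimura_of_isShortThreeTorsion
    {W : WeierstrassCurve ℚ} [W.IsElliptic] [W.IsGloballyMinimal] {N : ℕ} [NeZero N]
    (D : ModularParametrizationData W N) (hopt : ∀ z ∈ D.L.lattice, ∃ w ∈ periodLattice D.f, z = D.c * w)
    (h9 : 3 ^ 2 ∣ N) {X₀ : ℚ} {Y₀ : ℂ} (hT : IsShortThreeTorsionC W D.c X₀ Y₀)
    {u : ℂ} (hu₂ : 3 * u ∈ D.L.lattice) (hS : KummerShimura D u)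
    (hY : (D.c : ℂ) ^ 3 * D.L.derivWeierstrassP u / 2 = Y₀)
    {x₁ y₁ : ℚ} (hP : IsShortThreeTorsion W D.c x₁ y₁) : HasShortMuThree W D.c := by
  obtain ⟨r, hr, hr0⟩ := SigmaHabitat.sq_lt_zero_of_kummerShimura D hopt h9 hT hu₂ hS hY
  have hns := hT.1
  rw [WeierstrassCurve.Affine.nonsingular_iff', WeierstrassCurve.Affine.equation_iff'] at hns
  obtain ⟨heq, -⟩ := hns
  have ha₁ : (shortModel W D.c).a₁ = 0 := rfl
  have ha₂ : (shortModel W D.c).a₂ = 0 := rfl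
  have ha₃ : (shortModel W D.c).a₃ = 0 := rfl
  simp only [WeierstrassCurve.map_a₁, WeierstrassCurve.map_a₂, WeierstrassCurve.map_a₃, WeierstrassCurve.map_a₄,
    WeierstrassCurve.map_a₆, ha₁, ha₂, ha₃, map_zero, zero_mul, add_zero, eq_ratCast] at heq
  have hval : ((X₀ ^ 3 + (shortModel W D.c).a₄ * X₀ + (shortModel W D.c).a₆ : ℚ) : ℂ) = (r : ℂ) := by
    rw [hr]
    push_cast
    linear_combination -heq
  have hneg : X₀ ^ 3 + (shortModel W D.c).a₄ * X₀ + (shortModel W D.c).a₆ < 0 := by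
    rwa [show X₀ ^ 3 + (shortModel W D.c).a₄ * X₀ + (shortModel W D.c).a₆ = r by exact_mod_cast hval]
  exact hasShortMuThree_of_isShortThreeTorsion_of_isRoot_of_neg W D.c hP hT.2 hneg

end Summit.BirchSwinnertonDyer.BirchSwinnertonDyer.Theorems.ManinLocalTwoThree.HesseSplit

end
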